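import Mathlib
import Literature.Analysis.FluidPDE.CompressibleEulerImplosionCentreExpansionWindow2
import Summits.AtomisticToContinuum.HydrodynamicLimit.Theorems.ImplosionDichotomyDenseExcursionSonicCavityDefs

/-!
# The certified centre expansion of the pinned profile on `x ≤ −1/3` (crux `DenseExcursion`,
# line `sonic-cavity-renewal`, brick `centre_expansion_certified` of stub `stub_boxPackage`)

Helper file (`--supports stmt-AtomisticToContinuum-12586`) for the registered stub `stub_boxPackage` of the line
`sonic-cavity-renewal` (crux `Summit.AtomisticToContinuum.HydrodynamicLimit.Theses.ImplosionDichotomy.DenseExcursion`):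
the SERIES HALF of clause (d) of `CavityTube` (`…SonicCavityDefs`). On the core the pinned BCG profile `(W, S)` of
`exists_pinnedProfile_window2` is the even/odd part of the centre (origin) series of Buckmaster–Cao-Labora–Gómez-Serrano
read in `ζ = c eˣ` (`c = e^{T₀}`, `T₀` the sonic time of the `P₀` orbit):
`W = OriginSeries.CentreW2.Wser r c`, `S = OriginSeries.CentreW2.Sser r c`. The Literature theorem
`OriginSeries.CentreW2.centre_expansion_window2` (kernel-certified: r-uniform Taylor models of the first 60
coefficients, the restarted scalar majorant to order 200, the growth lemma beyond, termwise differentiation) gives the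
six inequalities of (d) with `W₂ = −w₃c²`, `s₀ = 1/(3c)`, `s₂ = w₂c/3` and remainder `2e^{4x}` for EVERY speed `r` in the
shooting window `[13890041/12500000, 697/625]` and EVERY sonic scale `c ∈ [1/3, 10/21]` (the range forced by
`7/10 ≤ s₀ ≤ 1`), on `x ≤ −1/3` (the reach of the centre series: `c·e^{−1/3} < 25/73`, the certified radius).

* `centre_expansion_certified` (registered) — the statement above, verbatim the six inequalities of `CavityTube` (d).

What is left for clause (d) of the witness: the identification `W = Wser r c`, `S = Sser r c` on `x ≤ −1/3` with
`c = e^{T₀} ∈ [1/3, 10/21]` (ODE uniqueness from the origin germ + an enclosure of the sonic time), and the near-sonic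
range `−1/3 ≤ x ≤ 0` (validated bridge).

Sources: Buckmaster–Cao-Labora–Gómez-Serrano 2025, Prop. 2.5, eq. (2.12), App. B.
-/

noncomputable section

namespace Summit.AtomisticToContinuum.HydrodynamicLimit.Theorems.SonicCavityRenewal

open Literature.Analysis.FluidPDE.BuckmasterCaolaboraGomezserrano2025

/-- **Brick `centre_expansion_certified` of stub `stub_boxPackage` (line `sonic-cavity-renewal`): THE CERTIFIED CENTRE
EXPANSION.** For every speed `r ∈ [13890041/12500000, 697/625]`, every sonic scale `c ∈ [1/3, 10/21]` and every
`x ≤ −1/3`, the series profile `(W, S) = (Wser r c, Sser r c)` satisfies the six second-order centre expansions of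
`CavityTube` (d) with `W₂ = −w₃c²`, `s₀ = 1/(3c)`, `s₂ = w₂c/3` (`|W₂| ≤ 1/10`, `7/10 ≤ s₀ ≤ 1`, `|s₂| ≤ 1/10`) and remainder
`2e^{4x}`. [cite: BuckmasterCaolaboraGomezserrano2025, Prop. 2.5, App. B] -/
theorem centre_expansion_certified : ∀ (r c : ℝ), (13890041 / 12500000 : ℝ) ≤ r → r ≤ 697 / 625 → 1 / 3 ≤ c → c ≤ 10 / 21 → |(-(OriginSeries.w r 1 3) * c ^ 2)| ≤ 1 / 10 ∧ 7 / 10 ≤ 1 / (3 * c) ∧ 1 / (3 * c) ≤ 1 ∧ |OriginSeries.w r 1 2 * c / 3| ≤ 1 / 10 ∧ ∀ x : ℝ, x ≤ -(1 / 3) → |OriginSeries.CentreW2.Wser r c x - (r - 1) - (-(OriginSeries.w r 1 3) * c ^ 2) * Real.exp (2 * x)| ≤ 2 * Real.exp (4 * x) ∧ |deriv (OriginSeries.CentreW2.Wser r c) x - 2 * (-(OriginSeries.w r 1 3) * c ^ 2) * Real.exp (2 * x)| ≤ 2 * Real.exp (4 * x) ∧ |deriv (deriv (OriginSeries.CentreW2.Wser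 r c)) x - 4 * (-(OriginSeries.w r 1 3) * c ^ 2) * Real.exp (2 * x)| ≤ 2 * Real.exp (4 * x) ∧ |Real.exp x * OriginSeries.CentreW2.Sser r c x - 1 / (3 * c) - (OriginSeries.w r 1 2 * c / 3) * Real.exp (2 * x)| ≤ 2 * Real.exp (4 * x) ∧ |deriv (fun y => Real.exp y * OriginSeries.CentreW2.Sser r c y) x - 2 * (OriginSeries.w r 1 2 * c / 3) * Real.exp (2 * x)| ≤ 2 * Real.exp (4 * x) ∧ |deriv (deriv (fun y => Real.exp y * OriginSeries.CentreW2.Sser r c y)) x - 4 * (OriginSeries.w r 1 2 * c / 3) * Real.exp (2 * x)| ≤ 2 * Real.exp (4 * x) := by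
  intro r c h1 h2 h3 h4
  have hr : r ∈ Set.Icc ((13890041/12500000 : ℚ) : ℝ) ((697/625 : ℚ) : ℝ) := by
    refine ⟨?_, ?_⟩ <;> push_cast <;> linarith
  exact OriginSeries.CentreW2.centre_expansion_window2 hr ⟨h3, h4⟩

end Summit.AtomisticToContinuum.HydrodynamicLimit.Theorems.SonicCavityRenewal

end
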